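import Literature.NumberTheory.EllipticCurves.Hsieh2012.NonvanishingHeckeLValuesModP
import HarnessLib

/-!
# Hsieh, Amer. J. Math. 134 (2012) §6, Remark 6.9 (2): Theorem 6.8 for the twists `χ = χ₁ν` by a
# character `ν ≡ 1 (mod 𝔪)`, with (R) replaced by (Rm) `W(χ*) ≡ 1 (mod 𝔪)` — NAMED FACT

Topic `Literature/NumberTheory/EllipticCurves` (namespace = path + paper key `Hsieh2012`). STATEMENT
FILE completing the §6 typing of `NonvanishingHeckeLValuesModP.lean` (Thm. A = 6.8, Cor. 6.5,
Rem. 6.9 (1)): ONE small definition with body — the root number `W(χ*)` of a character of infinity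
type `Σ + κ(1 − c)` that need NOT be self-dual, as a functional-equation PREDICATE `IsRootNumber`
(the sibling's `IsSelfDualRootNumber` is its self-dual form: PROVED equivalent in the companion
`NonvanishingHeckeLValuesModPCongruentTwistProofs.lean`) — and ONE named fact
`rem69_2_NV_of_isSelfDual_mul` (`def … : Prop`, cited, nothing asserted; D-0014); statements only,
no proofs. No `sorry`, no `instance`, no notation, no `_holds` (the proof is Thm. 6.8's: toric
Eisenstein series and Hida's density — SIZE XL ⇒ cite). Requested by the BSD wall (D-0154 (2) INPUTS, row `bsd-inputs-bed-p1`
"TYPE §6: Thm A, Cor 6.5, Thm 6.8, Rem 6.9", `--supports` item 21341); like the whole Hsieh 2012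
§6 package it documents the UNRAMIFIED-at-`p` mechanism (`(p, C) = 1`) and is not consumable on the
`p ∣ cond` branch of 21341 (there: `HeWei2025.thm14_NVInfinite_of_isSelfDual`). It proves nothing
about BSD. Remark 6.9 (3) (vanishing of the Gauss sums `A_β(χ_v)` / of `E^h_χ` mod `𝔪` when
`μ_p(χ_v) > 0` or `W(χ*) = −1` — objects internal to the proof; its `L`-value shadow for `W = −1`
is PROVED in `NonvanishingHeckeLValuesModPContinuationProofs.lean`) and (4) (commentary on the
non-split `𝔩` case) are not statements about tree objects and are not typed.

## The printed statement (arXiv:1208.4751v1 p. 24, `lit read` pagination = arXiv pages)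

Remark 6.9. "We give a few remarks on Theorem 6.8: … (2) Let `χ₁` be a self-dual character and `ν`
be a finite order character such that `ν` has prime-to-`p` conductor and `ν ≡ 1 (mod 𝔪)`. As
pointed out by the referee, one can prove Theorem 6.8 for `χ := χ₁ν`, keeping (L) and (C) but
replacing (R) by the condition (Rm): `W(χ*) ≡ 1 (mod 𝔪)`, which implies the condition (R) for
`χ₁`. Indeed, as `ν` must have square-free conductor, (C) holds for `χ₁`, and (L) obviously holds
for `χ₁` as well. Thus `χ₁` satisfies the hypothese in Theorem 6.8, and for every `u ∈ O_𝔩` and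
`r`, we can choose `β ∈ F₊` as in the proof of Prop. 6.7 such that `a_β(E^h_{χ₁}, 𝔠) ≢ 0 (mod 𝔪)`.
By the condition (L) the supports of the conductors of `χ` and `χ₁` only differ by split primes, we
find that `a_β(E^h_χ, 𝔠) ≢ 0 (mod 𝔪)`." Theorem 6.8 (p. 23): "Suppose that `𝔩` splits in `K`.
Let `χ` be a self-dual Hecke character such that (L) `μ_p(χ_v) = 0` for every `v ∣ C⁻`, (R) The
global root number `W(χ*) = 1`, (C) `R` is square-free. Then (NV) holds for `(χ, 𝔩)`", under §6.1's
"(unr), (ord) and `(p𝔩, D_{K/F}C) = 1`" (p. 20), `C` the conductor of `χ`, `χ* = χ|·|_{𝔸_K}^{−1/2}`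
(§4.1 p. 10), `W(χ*) = ∏_v W(χ*_v)` its global root number (Lemma 6.6, [MS00], [Tat79]).

## Transcription (binders as in the sibling file's (T1)–(T9); what is new is (T10)–(T12))

* (T10) `ν ≡ 1 (mod 𝔪)`, `ν` of finite order: the values of `ν` are roots of unity, and a root of
  unity is `≡ 1 (mod 𝔪)` iff its order is a power of `p`; typed as `∃ n, ν ^ p ^ n = 1` (which
  IMPLIES the printed congruence for every value). "prime-to-`p` conductor" = `ν` unramified at every
  `w ∣ p`. `χ := χ₁ν` has the Katz type `Σ + κ(1 − c)` of `χ₁` (`k = 1` forced by self-duality of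
  `χ₁`, sibling (T7); `hasKatzType_mul_of_isFiniteOrder`).
* (T11) (Rm) `W(χ*) ≡ 1 (mod 𝔪)` for the NOT necessarily self-dual `χ = χ₁ν` needs the general
  root number: `IsRootNumber κ χ W` := there are `B > 0` and ENTIRE `Λ, Λ′` with, for `re s > 1`,
  `Λ(s) = B^s ∏_w Γ_ℂ(s + κ_w + ½) L(s − ½, χ)` (`= Λ(s, χ*)`, `L(s, χ*) = L(s − ½, χ)`) and
  `Λ′(s) = B^s ∏_w Γ_ℂ(s + κ_w + ½) L(s + ½, χ⁻¹)` (`= Λ(s, χ̄*)`: `χ*` is unitary, so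
  `χ̄* = (χ*)⁻¹ = χ⁻¹|·|^{1/2}` and `L(s, χ̄*) = L(s + ½, χ⁻¹)`; same `Γ`-factor `Γ_ℂ(s + |m_w|/2)`,
  `m_w = ±(1 + 2κ_w)`, and same constant `B = (|d_K|N𝔣)^{1/2}`), and `Λ(s) = W·Λ′(1 − s)` for all
  `s` — the Hecke–Tate functional equation `Λ(s, χ*) = W(χ*)Λ(1 − s, χ̄*)` (Lemma 6.6 / [Tat79]).
  A PREDICATE on `(χ, W)`; the existence of `(B, Λ, Λ′, W)` is Hecke–Tate and is not asserted. `B`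
  existential still pins `W` (two solutions give `(B′/B)^{2s−1} = W′/W` on the non-vanishing locus
  of `Λ`). For SELF-DUAL `χ` this is the sibling's `IsSelfDualRootNumber κ χ W`: PROVED in the
  companion Proofs file (`IsSelfDual.isRootNumber_iff`: `χ⁻¹ = (χ∘c)·‖·‖⁻¹`, so
  `L(s + ½, χ⁻¹) = L(s − ½, χ∘c) = L(s − ½, χ)` and `Λ′ = Λ` by the identity theorem). (Rm) is then `∃ W, IsRootNumber κ χ W ∧ ‖ι⁻¹(W) − 1‖ < 1`
  (`ι⁻¹ = ι_p ∘ ι_∞⁻¹`; `x ≡ 1 (mod 𝔪) ⟺ ‖ι_p x − 1‖ < 1`).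
* (T12) The other binders are Theorem 6.8's for `χ = χ₁ν` VERBATIM (sibling `thmA_NV_of_isSelfDual`):
  (unr) `2 < p ∤ D_F`, (ord) `Σ_p`, `𝔩` split through `𝔏` with `c𝔏 ≠ 𝔏`, first regime
  `e(𝔏|ℓ) = f(𝔏|ℓ) = 1`, `(p𝔩, C) = 1` for `C = cond χ` (unramified above `p` and at `𝔏`, `c𝔏`),
  (L) and (C) for `χ` ("keeping (L) and (C)"); self-duality and (R) of Thm. 6.8 are replaced by
  "`χ₁` self-dual" and (Rm). Conclusion `NV ι ℓ 𝔏 (χ₁ν) 1 κ` (sibling (T5): CM period EXISTENTIAL —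
  weaker than print; first regime only). With `ν = 1` the fact specialises to Theorem 6.8 as typed
  (PROVED in the companion Proofs file: `thmA_of_rem69_2`), as it must.
  `-- TODO(general form): dim_{ℚ_ℓ} F_𝔩 > 1 (Zariski density); (NV) at the CM period Ω_∞.`

## References

* [Hsieh2012] M.-L. Hsieh, Amer. J. Math. 134 (2012) 1503–1539 = arXiv:1208.4751: Remark 6.9 (2)
  (p. 24), Theorem 6.8 (p. 23), §6.1 (p. 20), Lemma 6.6 (p. 22), §4.1 (p. 10), pp. 1–2.
* [TateThesis1967] J. Tate, thesis (1950), Thm. 4.4.1 (functional equation `Λ(s,χ) = W(χ)Λ(1−s, χ̄)`);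
  J. Tate, *Number theoretic background*, PSPM 33 (1979) §3 (root numbers).
* Tree: `Hsieh2012/NonvanishingHeckeLValuesModP.lean` (all vocabulary), `…ContinuationProofs.lean`
  (the `W = −1` shadow of Rem. 6.9 (3)), `…CongruentTwistProofs.lean` (bookkeeping for this file).
-/

noncomputable section

open scoped Classical
open NumberField IsDedekindDomain
open Literature.NumberTheory.GaloisRepresentations

namespace Literature.NumberTheory.EllipticCurves.Hsieh2012

/-! ### §10. The root number of a (not necessarily self-dual) character of type `Σ + κ(1 − c)` -/

section RootNumber

variable {K : Type} [Field K] [NumberField K]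

/-- **`W` is the global root number `W(χ*)` of `χ`**, `χ* := χ|·|_{𝔸_K}^{−1/2}` (§4.1 p. 10), for
`χ` of infinity type `Σ + κ(1 − c)` not necessarily self-dual (module docstring (T11)): there are
`B > 0` and entire `Λ`, `Λ′` with, for `re s > 1`, `Λ(s) = B^s ∏_w Γ_ℂ(s + κ_w + ½) L(s − ½, χ)`
and `Λ′(s) = B^s ∏_w Γ_ℂ(s + κ_w + ½) L(s + ½, χ⁻¹)` (the completed `L`-functions of the unitary
`χ*` and of `χ̄* = (χ*)⁻¹ = χ⁻¹|·|^{1/2}`), and `Λ(s) = W · Λ′(1 − s)` for all `s` — the Hecke–Tate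
functional equation `Λ(s, χ*) = W(χ*)Λ(1 − s, χ̄*)`. A predicate on `(χ, W)` (existence of the data
is Hecke–Tate, Lemma 6.6 cites [MS00]/[Tat79] for the local signs, and is not asserted); `B`
(`= (|d_K|N𝔣)^{1/2}` in print) existential, which still pins `W`. For self-dual `χ` it is the
sibling's `IsSelfDualRootNumber κ χ W` (`IsSelfDual.isRootNumber_iff`, Proofs file). Hypothesis (Rm) of
Remark 6.9 (2) reads `∃ W, IsRootNumber κ χ W ∧ ‖ι⁻¹ W − 1‖ < 1`.
[cite: Hsieh2012, §4.1 (p. 10, `χ*`), Lemma 6.6 (p. 22), Remark 6.9 (2) (p. 24, (Rm) `W(χ*) ≡ 1 (mod 𝔪)`)]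
[cite: TateThesis1967, Thm. 4.4.1] -/
def IsRootNumber (κ : InfinitePlace K → ℕ) (χ : HeckeCharacter K) (W : ℂ) : Prop :=
  ∃ B : ℝ, 0 < B ∧ ∃ Λ Λ' : ℂ → ℂ, Differentiable ℂ Λ ∧ Differentiable ℂ Λ' ∧
    (∀ s : ℂ, 1 < s.re →
      Λ s = (B : ℂ) ^ s * (∏ w, Complex.Gammaℂ (s + (κ w : ℂ) + 1 / 2)) *
        heckeLFunction χ (s - 1 / 2) ∧
      Λ' s = (B : ℂ) ^ s * (∏ w, Complex.Gammaℂ (s + (κ w : ℂ) + 1 / 2)) *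
        heckeLFunction χ⁻¹ (s + 1 / 2)) ∧
    ∀ s : ℂ, Λ s = W * Λ' (1 - s)

end RootNumber

/-! ### §11. The named fact: Remark 6.9 (2) -/

section Facts

/-- **Hsieh 2012, Remark 6.9 (2) (p. 24) — Theorem 6.8 for `χ := χ₁ν`, `χ₁` self-dual, `ν` of
finite order with prime-to-`p` conductor and `ν ≡ 1 (mod 𝔪)`, keeping (L) and (C) and replacing (R)
by (Rm) `W(χ*) ≡ 1 (mod 𝔪)`**, in the regime `dim_{ℚ_ℓ} F_𝔩 = 1`. Verbatim: "Let `χ₁` be a self-dual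
character and `ν` be a finite order character such that `ν` has prime-to-`p` conductor and
`ν ≡ 1 (mod 𝔪)`. As pointed out by the referee, one can prove Theorem 6.8 for `χ := χ₁ν`, keeping
(L) and (C) but replacing (R) by the condition (Rm): `W(χ*) ≡ 1 (mod 𝔪)`". Binders (module
docstring (T10)–(T12); sibling (T1)–(T9)): `2 < p ∤ D_F`; `K` CM; `Σ_p` a `p`-adic CM type; `ℓ ≠ p`
prime, `𝔏 ∣ ℓ` with `c𝔏 ≠ 𝔏` (`𝔩` splits) and `e(𝔏|ℓ) = f(𝔏|ℓ) = 1` (first regime); `χ₁` of infinity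
type `Σ + κ(1 − c)` and self-dual; `ν` of `p`-power order (`⇒ ν ≡ 1 (mod 𝔪)`, finite order) and
unramified above `p`; `χ = χ₁ν` unramified above `p` and at `𝔏`, `c𝔏` (`(p𝔩, C) = 1`); (L) at every
non-split place where `χ` ramifies; (C) conductor exponent of `χ` `≤ 1` at every place ramified in
`K/F`; (Rm) `∃ W, IsRootNumber κ χ W ∧ ‖ι⁻¹ W − 1‖ < 1`. Conclusion `NV ι ℓ 𝔏 (χ₁ν) 1 κ` (sibling
(T5): period existential — WEAKER than print). A published remark credited to the referee, with the
printed proof sketch; recorded as its own named fact. With `ν = 1` it gives Theorem 6.8 as typed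
(`thmA_of_rem69_2`, Proofs file). `-- TODO(general form): dim_{ℚ_ℓ} F_𝔩 > 1; (NV) at the CM period Ω_∞.`
[cite: Hsieh2012, Remark 6.9 (2) (p. 24) with Theorem 6.8 (p. 23), §6.1 (p. 20) and pp. 1–2 (setting, (NV), (L), (C))] -/
def rem69_2_NV_of_isSelfDual_mul : Prop :=
  ∀ (p : ℕ) [Fact p.Prime], 2 < p →
  ∀ (K : Type) [Field K] [NumberField K] [IsCMField K],
    ¬ (p : ℤ) ∣ NumberField.discr (maximalRealSubfield K) →
  ∀ (ι : PadicAlgCl p ≃+* ℂ) (Sp : Finset (HeightOneSpectrum (𝓞 K))), KatzCM.IsPAdicCMType p Sp →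
  ∀ (ℓ : ℕ) (𝔏 : HeightOneSpectrum (𝓞 K)), ℓ.Prime → ℓ ≠ p → ((ℓ : ℕ) : 𝓞 K) ∈ 𝔏.asIdeal →
    IsCMField.complexConj K • 𝔏 ≠ 𝔏 →
    𝔏.asIdeal.ramificationIdx ℤ = 1 → 𝔏.asIdeal.inertiaDeg ℤ = 1 →
  ∀ (χ₁ ν : HeckeCharacter K) (κ : InfinitePlace K → ℕ),
    KatzCM.HasKatzType ι Sp χ₁ 1 κ → IsSelfDual χ₁ →
    (∃ n : ℕ, ν ^ p ^ n = 1) →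
    (∀ w : HeightOneSpectrum (𝓞 K), ((p : ℕ) : 𝓞 K) ∈ w.asIdeal → ν.IsUnramifiedAt w) →
    (∀ w : HeightOneSpectrum (𝓞 K), ((p : ℕ) : 𝓞 K) ∈ w.asIdeal → (χ₁ * ν).IsUnramifiedAt w) →
    (χ₁ * ν).IsUnramifiedAt 𝔏 → (χ₁ * ν).IsUnramifiedAt (IsCMField.complexConj K • 𝔏) →
    (∀ w : HeightOneSpectrum (𝓞 K), IsCMField.complexConj K • w = w → ¬ (χ₁ * ν).IsUnramifiedAt w →
      HasLocalMuZero ι (χ₁ * ν) w) →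
    (∀ w : HeightOneSpectrum (𝓞 K), w.asIdeal.ramificationIdx (𝓞 (maximalRealSubfield K)) ≠ 1 →
      (χ₁ * ν).conductorExponentAt w ≤ 1) →
    (∃ W : ℂ, IsRootNumber κ (χ₁ * ν) W ∧ ‖ι.symm W - 1‖ < 1) →
    NV ι ℓ 𝔏 (χ₁ * ν) 1 κ

end Facts

end Literature.NumberTheory.EllipticCurves.Hsieh2012

end
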